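import Summits.BirchSwinnertonDyer.BirchSwinnertonDyer.Theses.CumulativeHeegnerLeopoldt
import Summits.BirchSwinnertonDyer.BirchSwinnertonDyer.Theorems.CumulativeHeegnerLeopoldtCumulativeHeegnerInclusionAtThreeSpecialisationValuesTempered
import Summits.BirchSwinnertonDyer.BirchSwinnertonDyer.Theorems.CumulativeHeegnerLeopoldtCumulativeHeegnerInclusionAtThreeB1OfPrint
import Summits.BirchSwinnertonDyer.BirchSwinnertonDyer.Theorems.CumulativeHeegnerLeopoldtCumulativeHeegnerInclusionAtThreeLineDeterminantAtThree
import Summits.BirchSwinnertonDyer.BirchSwinnertonDyer.Theorems.CumulativeHeegnerLeopoldtCumulativeHeegnerInclusionAtThreeBadPlacesSplitFinite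
import Summits.BirchSwinnertonDyer.BirchSwinnertonDyer.Theorems.CumulativeHeegnerLeopoldtCumulativeHeegnerInclusionAtThreeGlue
import Summits.BirchSwinnertonDyer.BirchSwinnertonDyer.Theorems.CumulativeHeegnerLeopoldtResidualSelmerFiniteAtThreeOfPrint
import Summits.BirchSwinnertonDyer.BirchSwinnertonDyer.Theorems.UniversalToricDescentAcDualMuZeroCriterion
import Summits.BirchSwinnertonDyer.Rank1Residual.X11b.AnticyclotomicModuleFinite
import HarnessLib

/-!
# Crux K1 `CumulativeHeegnerInclusionAtThree` (stmt-BirchSwinnertonDyer-24198), line `birth`: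
# **A ⟸ print ∧ (a TEMPERED Kolyvagin-system bound in INDEX currency)**, and hence K1 — BY NAME against the route decls

Lead prover bsd-line-chl-k1-p1 g5 (`--supports stmt-BirchSwinnertonDyer-24198`). Tempered twin of
`…CumulativeHeegnerInclusionAtThreeOfIndexBound`: the displayed hypothesis IB♮ is the OUTPUT FORMAT of a Kolyvagin-system argument run
with a tempered (`𝓗₁`-valued) Λ-adic class — the honest research residue (d♮) of memo TEMPERED-LINE-VIABILITY-g4: at every frame of K1
and for every radius `ρ < 1` there are `C_ρ ∈ ℕ` and `a_ρ ∈ Λ ∖ {0}` such that for every distinguished irreducible `Q ∈ ℤ_3[T]` prime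
to `a_ρ`, every root `y ∈ ℚ̄_3` of `Q` with `‖y‖ ≤ ρ` and the value `v = L(y)`:
`#(X_{∅,0}(𝔭′) ⧸ Q) · ‖v‖^{deg Q} ≤ 3^{C_ρ · deg Q}` (constants free to blow up toward the rim; finitely many exceptional primes per
radius; `Nat.card`, so primes dividing `char X` are vacuous). Through `…SpecialisationValuesTempered` (continuity + density +
g4's p624927) and the chain p628183 · p629845 · p630259 · p631301 this is ALREADY stub A (modulo print P), and K1 via the glue 26899.

* `temperedHeegnerInclusionAtThree_of_print_of_temperedIndexBound` : **P → IB♮ → A** (A = crux 26896 by name).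
* `cumulativeHeegnerInclusionAtThree_of_print_of_temperedIndexBound` : **P → IB♮ → K1**.

HONEST FRAMING: IB♮ is NOT proved here; no class, reciprocity law or Selmer bound is constructed. K1 = A + print stays OPEN.
No named fact, no `sorry`, no new definition. BSD is not proved by any of this; no summit statement is proved by this seat.
-/


set_option linter.dupNamespace false
set_option autoImplicit false

noncomputable section

open scoped Classical Polynomial

namespace Summit.BirchSwinnertonDyer.BirchSwinnertonDyer.Theorems.CumulativeHeegnerInclusionAtThreeOfTemperedIndexBound

open Literature.NumberTheory.EllipticCurves NumberField IsDedekindDomain Field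
  Summit.BirchSwinnertonDyer.Rank1Residual.X11b Summit.BirchSwinnertonDyer.Rank1Residual.X11b.AcSelmer
  Summit.BirchSwinnertonDyer.BirchSwinnertonDyer.Theorems.CumulativeHeegnerInclusionAtThreeSpecialisationValues
  Summit.BirchSwinnertonDyer.BirchSwinnertonDyer.Theorems.CumulativeHeegnerInclusionAtThreeSpecialisationValuesTempered

/-- The characteristic ideal of a `Λ`-module is non-zero (a finite product of powers of non-zero height-one primes,
or `1`). -/
theorem charIdeal_ne_bot_three (N : Type*) [AddCommGroup N] [Module (IwasawaAlgebra 3) N] :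
    Literature.NumberTheory.EllipticCurves.Module.charIdeal (IwasawaAlgebra 3) N ≠ ⊥ := by
  unfold Literature.NumberTheory.EllipticCurves.Module.charIdeal
  refine finprod_mem_induction (fun I : Ideal (IwasawaAlgebra 3) => I ≠ ⊥) ?_ (fun I J hI hJ => ?_) ?_
  · rw [Ideal.one_eq_top]
    exact top_ne_bot
  · exact fun h => (Ideal.mul_eq_bot.mp h).elim hI hJ
  · intro 𝔭 h𝔭 h
    have h1 : 𝔭.asIdeal ≠ ⊥ := Ideal.ne_bot_of_height_eq_one h𝔭
    rcases Nat.eq_zero_or_pos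
      (Literature.NumberTheory.EllipticCurves.Module.lengthAt (IwasawaAlgebra 3) N 𝔭).toNat with h0 | hpos
    · rw [h0, pow_zero, Ideal.one_eq_top] at h
      exact top_ne_bot h
    · exact h1 ((Ideal.pow_eq_bot hpos.ne').mp h)

/-- **A ⟸ PRINT ∧ TEMPERED INDEX BOUND.** If the print input P (`ResidualSelmerPrintedInputAtThree`) holds and, at every frame
of crux K1, the BDP function `L` satisfies a Kolyvagin-system-type bound in INDEX currency at the algebraic
specialisations — `#(X_{∅,0}(𝔭′) ⧸ Q) · ‖L(y)‖^{deg Q} ≤ 3^{C·deg Q}` for every distinguished irreducible `Q ∈ ℤ_3[T]` and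
every root `y ∈ ℚ̄_3` of `Q` — then the research crux A = stmt-26896 `TemperedHeegnerInclusionAtThree` holds. Proof:
P ⟹ `Sel[3]` finite (B1-from-print, p613183 with p614633/p613929) ⟹ `X` is `Λ`-torsion (UTD Greenberg criterion); `X`
is finitely generated (Castella §2.1, tree); `char X = (g₀)`, `g₀ ≠ 0`; then
`…SpecialisationValues.exists_C_pow_mul_mem_span_of_card_quotSMulTop_le` gives `3^μ·L ∈ (g₀·R₀⟦T⟧) =
(Ch_Λ X).map toUnr`. -/
theorem temperedHeegnerInclusionAtThree_of_print_of_temperedIndexBound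
    (hP : Summit.BirchSwinnertonDyer.BirchSwinnertonDyer.Theses.CumulativeHeegnerLeopoldt.ResidualSelmerPrintedInputAtThree)
    (hIB : ∀ (W : WeierstrassCurve ℚ) [W.IsElliptic] [W.IsGloballyMinimal] (N : ℕ) [NeZero N] (K : Type) [Field K] [NumberField K] (Dt : Literature.NumberTheory.EllipticCurves.ModularForms.ModularParametrizationData W N), Summit.BirchSwinnertonDyer.Rank1Residual.Additive.ClassO6 W 3 → Literature.NumberTheory.EllipticCurves.Rank1Residual.Red W 3 → (∃ Φ : AddSubgroup (WeierstrassCurve.geomTorsion W ((3 : ℕ) : ℤ)), Literature.NumberTheory.EllipticCurves.Rank1Residual.IsRationalLine W 3 Φ ∧ ∀ (v : IsDedekindDomain.HeightOneSpectrum (NumberField.RingOfIntegers ℚ)), ((3 : ℕ) : NumberField.RingOfIntegers ℚ) ∈ v.asIdeal → ∀ 𝔓 ∈ v.primesAbove, ¬ (∀ g ∈ 𝔓.decompositionSubgroup (Field.absoluteGaloisGroup ℚ), ∀ P ∈ Φ, g • P = P) ∧ ¬ (∀ g ∈ 𝔓.decompositionSubgroup (Field.absoluteGaloisGroup ℚ),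 ∀ P : WeierstrassCurve.geomTorsion W ((3 : ℕ) : ℤ), g • P - P ∈ Φ)) → W.analyticRank = 1 → W.conductorNorm ℤ = N → Literature.NumberTheory.EllipticCurves.IsImaginaryQuadratic K → Literature.NumberTheory.EllipticCurves.SatisfiesHeegnerHypothesis N K → ∀ (κ : Literature.NumberTheory.EllipticCurves.ZpExtension K 3), κ.IsAnticyclotomic → ∀ (γ : Field.absoluteGaloisGroup K) [Fact (κ.IsTopGenerator γ)] (𝔭 : IsDedekindDomain.HeightOneSpectrum (NumberField.RingOfIntegers K)), ((3 : ℕ) : NumberField.RingOfIntegers K) ∈ 𝔭.asIdeal → 𝔭.asIdeal.ramificationIdx (NumberField.RingOfIntegers ℚ) = 1 → 𝔭.asIdeal.inertiaDeg (NumberField.RingOfIntegers ℚ) = 1 → ∀ (𝔭' : IsDedekindDomain.HeightOneSpectrum (NumberField.RingOfIntegers K)), ((3 : ℕ) : NumberField.RingOfIntegers K) ∈ 𝔭'.asIdeal → 𝔭' ≠ 𝔭 → ∀ (ι' : PadicAlgCl 3 ≃+* ℂ), Summit.BirchSwinnertonDyer.BirchSwinnertonDyer.Theorems.SchneiderFree.BranchInducesPrime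 3 ι' 𝔭 → ∀ (ΩK : ℂ) (Ωp : ℂ_[3]) (L : Literature.NumberTheory.EllipticCurves.UnrSeries 3), ΩK ≠ 0 → Ωp ≠ 0 → Literature.NumberTheory.EllipticCurves.IsBDPLFunction ι' 𝔭 κ γ Dt.f ΩK Ωp L → ∀ ρ : ℝ, ρ < 1 → ∃ (C : ℕ) (a : IwasawaAlgebra 3), a ≠ 0 ∧ ∀ Q : ℤ_[3][X], Q.IsDistinguishedAt (IsLocalRing.maximalIdeal ℤ_[3]) → Irreducible Q → IsRelPrime a (Q : IwasawaAlgebra 3) → ∀ y : PadicAlgCl 3, Polynomial.aeval y (Q.map (algebraMap ℤ_[3] ℚ_[3])) = 0 → ‖(y : ℂ_[3])‖ ≤ ρ → ∀ v : ℂ_[3], L.HasValueAt (y : ℂ_[3]) v → (Nat.card (Summit.BirchSwinnertonDyer.Rank1Residual.X11b.AcSelmer.XAc (W.baseChange K) 3 κ 𝔭' ∅ γ ⧸ (Ideal.span {(Q : IwasawaAlgebra 3)} • ⊤ : Submodule (IwasawaAlgebra 3) (Summit.BirchSwinnertonDyer.Rank1Residual.X11b.AcSelmer.XAc (W.baseChange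 K) 3 κ 𝔭' ∅ γ))) : ℝ) * ‖v‖ ^ Q.natDegree ≤ (3 : ℝ) ^ (C * Q.natDegree)) :
    Summit.BirchSwinnertonDyer.BirchSwinnertonDyer.Theses.CumulativeHeegnerLeopoldt.TemperedHeegnerInclusionAtThree := by
  intro W _ _ N _ K _ _ Dt hO6 hRed hcell hr hN hK hHg κ hκ γ _ 𝔭 h𝔭 he hf 𝔭' h𝔭' hne ι' hι ΩK Ωp L hΩK hΩp hBDP
  haveI : (W.baseChange K).IsElliptic := inferInstanceAs (W.map (algebraMap ℚ K)).IsElliptic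
  set X := XAc (W.baseChange K) 3 κ 𝔭' ∅ γ with hXdef
  haveI : Module.Finite (IwasawaAlgebra 3) X := XAc.module_finite_empty κ 𝔭' γ
  -- torsion-ness of `X` from print (B1 ⟹ Greenberg criterion)
  have hfin :=
    Summit.BirchSwinnertonDyer.BirchSwinnertonDyer.Theorems.CumulativeHeegnerInclusionAtThreeB1OfPrint.stub_residualSelmerFinite_of_print
      hP
      Summit.BirchSwinnertonDyer.BirchSwinnertonDyer.Theorems.CumulativeHeegnerInclusionAtThreeLineDet.stub_lineDeterminantAtThree
      Summit.BirchSwinnertonDyer.BirchSwinnertonDyer.Theorems.CumulativeHeegnerInclusionAtThreeBadPlaces.stub_badPlacesSplitFinite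
      W N K hO6 hRed hcell hN hK hHg κ hκ 𝔭' h𝔭'
  obtain ⟨hT, -⟩ :=
    Summit.BirchSwinnertonDyer.BirchSwinnertonDyer.Theorems.UniversalToricDescentAcDualMuZero.isTorsion_and_exists_generator_of_finite_pTorsion
      (W.baseChange K) 3 κ 𝔭' ∅ γ Set.finite_empty hfin
  -- a generator of `char X` in `Λ`
  obtain ⟨g₀, hg₀'⟩ := (charIdeal_isPrincipal_holds 3 X).principal
  have hg₀ : Literature.NumberTheory.EllipticCurves.Module.charIdeal (IwasawaAlgebra 3) X = Ideal.span {g₀} := by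
    rw [hg₀', Ideal.submodule_span_eq]
  have hg0 : g₀ ≠ 0 := by
    intro h0
    apply charIdeal_ne_bot_three X
    rw [hg₀, h0, Ideal.span_singleton_eq_bot]
  -- the index bound at this frame, and the landed chain
  have hC := hIB W N K Dt hO6 hRed hcell hr hN hK hHg κ hκ γ 𝔭 h𝔭 he hf 𝔭' h𝔭' hne ι' hι ΩK Ωp L hΩK hΩp hBDP
  obtain ⟨μ, hμ⟩ := exists_C_pow_mul_mem_span_of_card_quotSMulTop_le_tempered (p := 3) X hT hg₀ hg0 (L := L)
    (fun ρ hρ => by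
      obtain ⟨C, a, ha, h⟩ := hC ρ hρ
      exact ⟨C, a, ha, fun Q hQ hirr _ haQ y hy hyρ v hv => h Q hQ hirr haQ y hy hyρ v hv⟩)
  refine ⟨μ, ?_⟩
  rw [show XAc.charIdeal (W.baseChange K) 3 κ 𝔭' ∅ γ =
      Literature.NumberTheory.EllipticCurves.Module.charIdeal (IwasawaAlgebra 3) X from rfl, hg₀, Ideal.map_span,
    Set.image_singleton, Ideal.span_singleton_le_iff_mem]
  have heq : (3 : UnrSeries 3) ^ μ * L = PowerSeries.C (((3 : ℕ) : unrIntegers 3) ^ μ) * L := by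
    rw [map_pow, map_natCast]
    norm_cast
  rw [heq]
  exact hμ

/-- **K1 ⟸ PRINT ∧ TEMPERED INDEX BOUND**: with the landed glue of the rev-5 split (stmt-26899, p615902:
`A → P → B1P → K1`) and the B1P closer (stmt-26898, p616187), the route crux `CumulativeHeegnerInclusionAtThree` follows
from P and the index-currency bound IB. The line `birth` thus closes K1 from print the moment a Kolyvagin-system
argument for crux 26896 outputs its bound in the standard specialisation-wise index format. -/
theorem cumulativeHeegnerInclusionAtThree_of_print_of_temperedIndexBound
    (hP : Summit.BirchSwinnertonDyer.BirchSwinnertonDyer.Theses.CumulativeHeegnerLeopoldt.ResidualSelmerPrintedInputAtThree)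
    (hIB : ∀ (W : WeierstrassCurve ℚ) [W.IsElliptic] [W.IsGloballyMinimal] (N : ℕ) [NeZero N] (K : Type) [Field K] [NumberField K] (Dt : Literature.NumberTheory.EllipticCurves.ModularForms.ModularParametrizationData W N), Summit.BirchSwinnertonDyer.Rank1Residual.Additive.ClassO6 W 3 → Literature.NumberTheory.EllipticCurves.Rank1Residual.Red W 3 → (∃ Φ : AddSubgroup (WeierstrassCurve.geomTorsion W ((3 : ℕ) : ℤ)), Literature.NumberTheory.EllipticCurves.Rank1Residual.IsRationalLine W 3 Φ ∧ ∀ (v : IsDedekindDomain.HeightOneSpectrum (NumberField.RingOfIntegers ℚ)), ((3 : ℕ) : NumberField.RingOfIntegers ℚ) ∈ v.asIdeal → ∀ 𝔓 ∈ v.primesAbove, ¬ (∀ g ∈ 𝔓.decompositionSubgroup (Field.absoluteGaloisGroup ℚ), ∀ P ∈ Φ, g • P = P) ∧ ¬ (∀ g ∈ 𝔓.decompositionSubgroup (Field.absoluteGaloisGroup ℚ), ∀ P : WeierstrassCurve.geomTorsion W ((3 : ℕ) : ℤ), g • P - P ∈ Φ)) → W.analyticRank = 1 → W.conductorNorm ℤ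 = N → Literature.NumberTheory.EllipticCurves.IsImaginaryQuadratic K → Literature.NumberTheory.EllipticCurves.SatisfiesHeegnerHypothesis N K → ∀ (κ : Literature.NumberTheory.EllipticCurves.ZpExtension K 3), κ.IsAnticyclotomic → ∀ (γ : Field.absoluteGaloisGroup K) [Fact (κ.IsTopGenerator γ)] (𝔭 : IsDedekindDomain.HeightOneSpectrum (NumberField.RingOfIntegers K)), ((3 : ℕ) : NumberField.RingOfIntegers K) ∈ 𝔭.asIdeal → 𝔭.asIdeal.ramificationIdx (NumberField.RingOfIntegers ℚ) = 1 → 𝔭.asIdeal.inertiaDeg (NumberField.RingOfIntegers ℚ) = 1 → ∀ (𝔭' : IsDedekindDomain.HeightOneSpectrum (NumberField.RingOfIntegers K)), ((3 : ℕ) : NumberField.RingOfIntegers K) ∈ 𝔭'.asIdeal → 𝔭' ≠ 𝔭 → ∀ (ι' : PadicAlgCl 3 ≃+* ℂ), Summit.BirchSwinnertonDyer.BirchSwinnertonDyer.Theorems.SchneiderFree.BranchInducesPrime 3 ι' 𝔭 → ∀ (ΩK : ℂ) (Ωp : ℂ_[3]) (L : Literature.NumberTheory.EllipticCurves.UnrSeries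 3), ΩK ≠ 0 → Ωp ≠ 0 → Literature.NumberTheory.EllipticCurves.IsBDPLFunction ι' 𝔭 κ γ Dt.f ΩK Ωp L → ∀ ρ : ℝ, ρ < 1 → ∃ (C : ℕ) (a : IwasawaAlgebra 3), a ≠ 0 ∧ ∀ Q : ℤ_[3][X], Q.IsDistinguishedAt (IsLocalRing.maximalIdeal ℤ_[3]) → Irreducible Q → IsRelPrime a (Q : IwasawaAlgebra 3) → ∀ y : PadicAlgCl 3, Polynomial.aeval y (Q.map (algebraMap ℤ_[3] ℚ_[3])) = 0 → ‖(y : ℂ_[3])‖ ≤ ρ → ∀ v : ℂ_[3], L.HasValueAt (y : ℂ_[3]) v → (Nat.card (Summit.BirchSwinnertonDyer.Rank1Residual.X11b.AcSelmer.XAc (W.baseChange K) 3 κ 𝔭' ∅ γ ⧸ (Ideal.span {(Q : IwasawaAlgebra 3)} • ⊤ : Submodule (IwasawaAlgebra 3) (Summit.BirchSwinnertonDyer.Rank1Residual.X11b.AcSelmer.XAc (W.baseChange K) 3 κ 𝔭' ∅ γ))) : ℝ) * ‖v‖ ^ Q.natDegree ≤ (3 : ℝ) ^ (C * Q.natDegree))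 :
    Summit.BirchSwinnertonDyer.BirchSwinnertonDyer.Theses.CumulativeHeegnerLeopoldt.CumulativeHeegnerInclusionAtThree :=
  Summit.BirchSwinnertonDyer.BirchSwinnertonDyer.Theorems.cumulativeHeegnerLeopoldt_cumulativeHeegnerInclusionAtThreeGlue_proof
    (temperedHeegnerInclusionAtThree_of_print_of_temperedIndexBound hP hIB) hP
    Summit.BirchSwinnertonDyer.BirchSwinnertonDyer.Theorems.cumulativeHeegnerLeopoldt_residualSelmerFiniteAtThreeOfPrint_proof

end Summit.BirchSwinnertonDyer.BirchSwinnertonDyer.Theorems.CumulativeHeegnerInclusionAtThreeOfTemperedIndexBound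

end
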